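import Summits.ABC.StewartYu.PadicG3SchedS
import Summits.ABC.StewartYu.PadicG3EndG
import Summits.ABC.StewartYu.PadicG3ParVA
import Summits.ABC.StewartYu.PadicG3Exits
import HarnessLib

/-!
# Cell abc-stewartyu, crux `Y07Odd` (stmt-ABC-19658), line `gen3-slab-odd`: the two record branches as INSTANCES of `G3Sched` and their END sizing
# (plan g8 03:39Z: `m = 0` → `PadicG3ParV` (R1′), `m ≥ 1` → v1 `PadicG3Par`; ∃-assembly by cases = p2)

`Summits/ABC/StewartYu/PadicG3SchedInst.lean` — cell `abc-stewartyu` (seat p2-g4, F-odd lead).  Definitions `schedV P` (box scale `LV`, `L0V`, `HV`,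
`SdG`, `XsV`, `TV`, `MordV`) and `sched1 P` (v1: `L`, `L₀`, `H`, `Sdepth`, `Xs`, `T`, `Mord`) with their decrement laws
(`MordV_sub_succ`/`MordV_level`; v1 `Mord_sub_succ` and `2·T(s+1) ≤ T s`), rfl field lemmas, the generic END range `XfinOS`, and the END
sizing of each branch: `endSizingV` (END data `(XfinOS, S0NV, D0V, DV)`) and `endSizing1` (`(XfinOS, S₀N, D₀, D)`).  No named fact.

References: Yu. V. Nesterenko, LNM 1819 (2003) (4.3)–(4.5), §5.
-/

noncomputable section

open Finset
open Literature.NumberTheory.Transcendental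

namespace Summit.ABC.StewartYu

namespace PadicG3Par

variable {n : ℕ} (P : PadicG3Par n)

/-- v1: `2·T(s+1) ≤ T s` (`T s = 8L/2^s`). [folklore] -/
theorem two_mul_T_succ_le (s : ℕ) : 2 * P.T (s + 1) ≤ P.T s := by
  unfold T
  rw [pow_succ, ← Nat.div_div_eq_div_mul, mul_comm]
  exact Nat.div_mul_le_self _ _

/-- v1: the half-step decrement law `Mord (s+1) 0 + T s ≤ Mord s n`. [cite: Nesterenko2003, (4.5)] -/
theorem Mord_half_law (s : ℕ) : P.Mord (s + 1) 0 + P.T s ≤ P.Mord s n := by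
  unfold Mord
  have h := P.two_mul_T_succ_le s
  have h2 : 2 * (n + 1) - n = n + 2 := by omega
  rw [h2, Nat.sub_zero]
  nlinarith

/-- **The `m = 0` branch schedule** (`PadicG3ParV`, R1′). [cite: Nesterenko2003, (4.3)–(4.5); shape only] -/
def schedV : G3Sched n where
  m := P.m
  Lbox := P.LV
  A := P.A
  L₀ := P.L0V
  H := P.HV
  Sd := P.SdG
  Xs := P.XsV
  T := P.TV
  Mord := P.MordV
  hA := P.A_pos
  hH := P.one_le_HV
  kstep_law := fun s ν hν => (P.MordV_sub_succ s ν hν.le).symm.le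
  half_law := fun s hs => by rw [← P.MordV_level s hs]; exact (P.MordV_sub_succ s n le_rfl).symm.le

/-- **The `m ≥ 1` branch schedule** (v1 `PadicG3Par`). [cite: Nesterenko2003, (4.3)–(4.5); shape only] -/
def sched1 : G3Sched n where
  m := P.m
  Lbox := P.L
  A := P.A
  L₀ := P.L₀
  H := P.H
  Sd := P.Sdepth
  Xs := P.Xs
  T := P.T
  Mord := P.Mord
  hA := P.A_pos
  hH := by unfold H; exact le_max_left _ _
  kstep_law := fun s ν hν => (P.Mord_sub_succ s ν (by omega)).symm.le
  half_law := fun s _ => P.Mord_half_law s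

/-! rfl field lemmas -/
section
/-- field. [folklore] -/ theorem schedV_m : P.schedV.m = P.m := rfl
/-- field. [folklore] -/ theorem schedV_Lbox : P.schedV.Lbox = P.LV := rfl
/-- field. [folklore] -/ theorem schedV_A : P.schedV.A = P.A := rfl
/-- field. [folklore] -/ theorem schedV_L₀ : P.schedV.L₀ = P.L0V := rfl
/-- field. [folklore] -/ theorem schedV_H : P.schedV.H = P.HV := rfl
/-- field. [folklore] -/ theorem schedV_Sd : P.schedV.Sd = P.SdG := rfl
/-- field. [folklore] -/ theorem schedV_Xs : P.schedV.Xs = P.XsV := rfl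
/-- field. [folklore] -/ theorem schedV_T : P.schedV.T = P.TV := rfl
/-- field. [folklore] -/ theorem schedV_Mord : P.schedV.Mord = P.MordV := rfl
/-- field. [folklore] -/ theorem sched1_m : P.sched1.m = P.m := rfl
/-- field. [folklore] -/ theorem sched1_Lbox : P.sched1.Lbox = P.L := rfl
/-- field. [folklore] -/ theorem sched1_A : P.sched1.A = P.A := rfl
/-- field. [folklore] -/ theorem sched1_L₀ : P.sched1.L₀ = P.L₀ := rfl
/-- field. [folklore] -/ theorem sched1_H : P.sched1.H = P.H := rfl
/-- field. [folklore] -/ theorem sched1_Sd : P.sched1.Sd = P.Sdepth := rfl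
/-- field. [folklore] -/ theorem sched1_Xs : P.sched1.Xs = P.Xs := rfl
/-- field. [folklore] -/ theorem sched1_T : P.sched1.T = P.T := rfl
/-- field. [folklore] -/ theorem sched1_Mord : P.sched1.Mord = P.Mord := rfl
end

end PadicG3Par

namespace G3Setup

variable {p : ℕ} [Fact p.Prime] (S : G3Setup p) (Sc : G3Sched S.n) (P : PadicG3Par S.n)

/-- The END range over an abstract schedule: `⌊NS Sd n / (2(n+1))⌋`. [cite: Nesterenko2003, (5.4); shape only] -/
def XfinOS : ℕ := S.NS Sc Sc.Sd S.n / (2 * (S.n + 1))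

/-- `2(n+1)·XfinOS ≤ NS Sd n`. [folklore] -/
theorem two_mul_XfinOS_le : 2 * ((S.n + 1) * S.XfinOS Sc) ≤ S.NS Sc Sc.Sd S.n := by
  unfold XfinOS
  rw [← mul_assoc, mul_comm]
  exact Nat.div_mul_le_self _ _

/-- `(n+1)·S₀ < TordS Sd n` from `1 ≤ S₀` and `(n+2)·S₀ ≤ Mord Sd n`. [folklore] -/
theorem succ_mul_lt_TordS_last {S₀ : ℕ} (h1 : 1 ≤ S₀) (h2 : (S.n + 2) * S₀ ≤ Sc.Mord Sc.Sd S.n) : (S.n + 1) * S₀ < S.TordS Sc Sc.Sd S.n := by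
  rw [S.TordS_last]
  calc (S.n + 1) * S₀ < (S.n + 2) * S₀ := Nat.mul_lt_mul_of_pos_right (by omega) (by omega)
    _ ≤ Sc.Mord Sc.Sd S.n := h2

/-- `2·Lb sideS Sd j ≤ ⌊Nq·Lbox/(2^Sd Aⱼ)⌋ + 1` for `Nq ≥ 1`. [cite: Nesterenko2003, §5.2; shape only] -/
theorem two_mul_Lb_sideS_le {Nq : ℕ} (hNq : 1 ≤ Nq) (hL : 0 ≤ Sc.Lbox) (j : Fin S.n) :
    2 * S.Lb (S.sideS Sc) Sc.Sd j ≤ ⌊(Nq : ℝ) * Sc.Lbox / (2 ^ Sc.Sd * Sc.A j)⌋₊ + 1 := by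
  have hA := Sc.hA j
  have hside : (S.sideS Sc j : ℝ) ≤ Sc.Lbox / (4 * Sc.A j) := by unfold sideS; exact Nat.floor_le (by positivity)
  have hLb := S.Lb_le_real (S.sideS Sc) Sc.Sd j
  have hreal : (2 * S.Lb (S.sideS Sc) Sc.Sd j : ℝ) ≤ (Nq : ℝ) * Sc.Lbox / ((2 : ℝ) ^ Sc.Sd * Sc.A j) := by
    have hNq' : (1 : ℝ) ≤ Nq := by exact_mod_cast hNq
    calc (2 * S.Lb (S.sideS Sc) Sc.Sd j : ℝ) ≤ 2 * (2 * (S.sideS Sc j : ℝ) / (2 : ℝ) ^ Sc.Sd) := by linarith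
      _ ≤ 2 * (2 * (Sc.Lbox / (4 * Sc.A j)) / (2 : ℝ) ^ Sc.Sd) := by gcongr
      _ = 1 * Sc.Lbox / ((2 : ℝ) ^ Sc.Sd * Sc.A j) := by field_simp; ring
      _ ≤ (Nq : ℝ) * Sc.Lbox / ((2 : ℝ) ^ Sc.Sd * Sc.A j) := by gcongr
  have : 2 * S.Lb (S.sideS Sc) Sc.Sd j ≤ ⌊(Nq : ℝ) * Sc.Lbox / (2 ^ Sc.Sd * Sc.A j)⌋₊ := Nat.le_floor (by exact_mod_cast hreal)
  omega

/-- **END sizing of the `m = 0` branch** with END data `(XfinOS, S0NV, D0V, DV)`. [cite: Nesterenko2003, §5; shape only] -/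
theorem endSizingV : 2 * ((S.n + 1) * S.XfinOS P.schedV) ≤ S.NS P.schedV P.schedV.Sd S.n ∧
    (S.n + 1) * P.S0NV < S.TordS P.schedV P.schedV.Sd S.n ∧ P.schedV.L₀ ≤ P.D0V ∧ ∀ j, 2 * S.Lb (S.sideS P.schedV) P.schedV.Sd j ≤ P.DV j := by
  refine ⟨S.two_mul_XfinOS_le P.schedV, ?_, ?_, fun j => ?_⟩
  · refine S.succ_mul_lt_TordS_last P.schedV ?_ ?_
    · have hK := P.K1V
      have hn := P.hn
      have : 2 ≤ 2 * S.n * (S.n + 1) * (P.LgV / 2 ^ (S.n + 22) + 1) := by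
        have h1 : 1 ≤ P.LgV / 2 ^ (S.n + 22) + 1 := Nat.le_add_left 1 _
        calc 2 = 2 * 1 * 1 * 1 := by ring
          _ ≤ 2 * S.n * (S.n + 1) * (P.LgV / 2 ^ (S.n + 22) + 1) := by (gcongr; omega)
      generalize 2 * S.n * (S.n + 1) * (P.LgV / 2 ^ (S.n + 22) + 1) = e at this hK
      omega
    · show (S.n + 2) * P.S0NV ≤ P.MordV P.SdG S.n
      refine le_trans ?_ (P.MV_div_le_MordV P.SdG S.n)
      unfold PadicG3Par.S0NV
      rw [show P.MV / (S.n + 2) ^ 4 = P.MV / (S.n + 2) ^ 3 / (S.n + 2) by rw [Nat.div_div_eq_div_mul, ← pow_succ], mul_comm]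
      exact Nat.div_mul_le_self _ _
  · show P.L0V ≤ P.D0V
    unfold PadicG3Par.D0V; omega
  · have h := S.two_mul_Lb_sideS_le P.schedV P.hNq (by show (0 : ℝ) ≤ (P.LV : ℝ); positivity) j
    unfold PadicG3Par.DV
    exact h

/-- **END sizing of the `m ≥ 1` branch** with END data `(XfinOS, S₀N, D₀, D)`. [cite: Nesterenko2003, §5; shape only] -/
theorem endSizing1 : 2 * ((S.n + 1) * S.XfinOS P.sched1) ≤ S.NS P.sched1 P.sched1.Sd S.n ∧
    (S.n + 1) * P.S₀N < S.TordS P.sched1 P.sched1.Sd S.n ∧ P.sched1.L₀ ≤ P.D₀ ∧ ∀ j, 2 * S.Lb (S.sideS P.sched1) P.sched1.Sd j ≤ P.D j := by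
  refine ⟨S.two_mul_XfinOS_le P.sched1, ?_, ?_, fun j => ?_⟩
  · refine S.succ_mul_lt_TordS_last P.sched1 ?_ ?_
    · have hK := P.K1
      have hn := P.hn
      have : 2 ≤ 2 * S.n * (S.n + 1) * (P.L / 2 ^ (S.n + 22) + 1) := by
        have h1 : 1 ≤ P.L / 2 ^ (S.n + 22) + 1 := Nat.le_add_left 1 _
        calc 2 = 2 * 1 * 1 * 1 := by ring
          _ ≤ 2 * S.n * (S.n + 1) * (P.L / 2 ^ (S.n + 22) + 1) := by (gcongr; omega)
      generalize 2 * S.n * (S.n + 1) * (P.L / 2 ^ (S.n + 22) + 1) = e at this hK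
      omega
    · show (S.n + 2) * P.S₀N ≤ P.Mord P.Sdepth S.n
      refine le_trans ?_ (P.M_div_le_Mord P.Sdepth S.n)
      unfold PadicG3Par.S₀N
      rw [show P.M / (S.n + 2) ^ 4 = P.M / (S.n + 2) ^ 3 / (S.n + 2) by rw [Nat.div_div_eq_div_mul, ← pow_succ], mul_comm]
      exact Nat.div_mul_le_self _ _
  · show P.L₀ ≤ P.D₀
    unfold PadicG3Par.D₀; omega
  · have h := S.two_mul_Lb_sideS_le P.sched1 P.hNq (by show (0 : ℝ) ≤ (P.L : ℝ); positivity) j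
    unfold PadicG3Par.D
    exact h

end G3Setup

end Summit.ABC.StewartYu

end
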